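/-
Copyright (c) 2026. All rights reserved.
Released under Apache 2.0 license as described in the file LICENSE.
Authors: abc-iut cell, prover seat abc-iut-L4-t12 (gen 8).
-/
import Literature.AnabelianGeometry.AbsoluteAnabelian.ArchimedeanHolFieldFunctorGeometricOverIdRigidInstances
import Literature.Analysis.Complex.ThricePuncturedSphereAutomorphisms
import HarnessLib

/-!
# [AbsTopIII] Prop 4.2 (i), geometric column: (H1) at the thrice-punctured sphere, unconditionally

PROOF-ONLY file (abc-iut cell, campaign-L item R1.2 of the `EA` column of [AbsTopIII] Prop 4.2 /
Cor 4.5; classical).  The reduction `HolRS.isIdRigid_mapsTo_planeComplFinite_of`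
(`ArchimedeanHolFieldFunctorGeometricOverIdRigidInstances.lean`) left ONE input at the object `ℂ ∖ F` of
abc-iut-L4-t14's geometric model `HolRS` of print's `EA` (S. Mochizuki, *Topics in Absolute Anabelian
Geometry III*, proof of Prop 4.2 (i), kurims p.106 l.11–19):

> (H1) every automorphism of `ℂ ∖ F` in `HolRS` commuting with all its holomorphic finite étale
> endomorphisms is the identity.

Here (H1) is DISCHARGED at `F = {0, 1}`, the thrice-punctured sphere `ℙ¹ ∖ {0, 1, ∞} = ℂ ∖ {0, 1}`, from
the tree's classification of its biholomorphic automorphisms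
(`Literature.Analysis.Complex.ThricePunctured.eq_one_of_six`: `Aut^hol(ℂ ∖ {0,1})` is the anharmonic
group of the six Möbius transformations permuting `0, 1, ∞` — J. B. Conway, *Functions of One Complex
Variable I*, Ch. V Thm. 1.21): the anharmonic group `≅ 𝔖₃` is centre-free, and already the two
generators `z ↦ 1 - z`, `z ↦ z⁻¹` — which ARE holomorphic finite étale endomorphisms — commute with none
of the five non-identity elements (evaluate at `z = 2`).

* `HolRS.exists_mem_holAut_of_iso` — JUNCTION: an automorphism of `HolRS.ofOpen U` (a connected open
  `U ⊆ ℂ` as a Riemann surface) in `HolRS` has an underlying element of abc-iut-L4-t2's `holAut U`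
  ([AbsTopIII] Def 2.1 (i), `Aut^hol(U)`);
* `HolRS.exists_hom_of_mem_holAut` — conversely every element of `holAut U` underlies an endomorphism
  (indeed an automorphism) of `HolRS.ofOpen U` in `HolRS`;
* `HolRS.h1_of_iso` — (H1) is invariant under isomorphism (any category);
* **`HolRS.tripod_h1`** — (H1) holds at `ℂ ∖ {0, 1}`;
* **`HolRS.isIdRigid_mapsTo_thricePuncturedSphere`** — hence, UNCONDITIONALLY: for every `Q ⊆ HolRS`
  closed under finite étale covers with `ℂ ∖ {0,1} ∈ Q`, the full subcategory of `EA^hol_RS(Q)` of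
  objects mapping to `ℂ ∖ {0, 1}` is id-rigid (print's per-object statement of the proof of Prop 4.2 (i),
  at this object of the geometric model);
* `HolRS.planeComplPair_h1`, `HolRS.isIdRigid_mapsTo_planeComplPair`,
  `HolRS.isIdRigid_mapsTo_planeComplFinite_of_ncard_eq_two` — the same for every twice-punctured plane
  `ℂ ∖ {p, q}`, `p ≠ q`, i.e. the `|F| = 2` case with NO residual hypothesis (affine change of variable
  `z ↦ (z - p)/(q - p)`, `HolRS.nonempty_iso_planeComplPair_tripod`).

HONEST SCOPE: model level (OUR category `HolRS` of connected Riemann surfaces / holomorphic finite étale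
maps); the orbicurve objects of print's `EA`, uniformisation and Lemma 4.3 are not touched; (H1) at
`ℂ ∖ F` for `|F| ≥ 3` is NOT treated (for special configurations the finite group `Aut(ℂ ∖ F)` has
non-trivial centre, e.g. `F = {0, 1, -1}`, so (H1) — a SUFFICIENT criterion only — is not the route
there); nothing here bears on [IUTchIII] Cor. 3.12; model ≠ reconstruction; support library, not a node.
No definitions, no instances, no Prop facts.

## References

* S. Mochizuki, *Topics in Absolute Anabelian Geometry III*, kurims ms, proof of Prop 4.2 (i) p.106
  l.11–19; Def 2.1 (i) p.50; Def 4.1 (i)/(iii) pp.101–103. [MochizukiAbsTopIII2015]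
* J. B. Conway, *Functions of One Complex Variable I*, GTM 11 (1978), Ch. V Thm. 1.21. [Conway1978]
-/

noncomputable section

open CategoryTheory Set Topology TopologicalSpace
open scoped Manifold ContDiff
open Literature.Topology.CoveringSpaces
open Literature.Analysis.Complex

namespace Literature.AnabelianGeometry.AbsoluteAnabelian

namespace HolRS

/-! ### §1 Junction: automorphisms of `ofOpen U` in `HolRS` versus `Aut^hol(U)` -/

/-- The underlying maps of an isomorphism of `HolRS` are mutually inverse (pointwise, first form).
[cite: MochizukiAbsTopIII2015, Definition 4.1 (iii) p.103] -/
theorem iso_inv_toFun_apply {X Y : HolRS} (a : X ≅ Y) (x : X.carrier) :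
    a.inv.toFun (a.hom.toFun x) = x := by
  have h := congrArg Hom.toFun a.hom_inv_id
  rw [comp_toFun, id_toFun] at h
  exact congrFun h x

/-- The underlying maps of an isomorphism of `HolRS` are mutually inverse (pointwise, second form).
[cite: MochizukiAbsTopIII2015, Definition 4.1 (iii) p.103] -/
theorem iso_hom_toFun_apply {X Y : HolRS} (a : X ≅ Y) (y : Y.carrier) :
    a.hom.toFun (a.inv.toFun y) = y := by
  have h := congrArg Hom.toFun a.inv_hom_id
  rw [comp_toFun, id_toFun] at h
  exact congrFun h y

/-- **An isomorphism of `HolRS` has an underlying homeomorphism, holomorphic in both directions.**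
[cite: MochizukiAbsTopIII2015, Definition 4.1 (iii) p.103] -/
theorem exists_homeomorph_of_iso {X Y : HolRS} (a : X ≅ Y) :
    ∃ e : X.carrier ≃ₜ Y.carrier, (⇑e = a.hom.toFun) ∧ (⇑e.symm = a.inv.toFun) ∧
      MDifferentiable 𝓘(ℂ, ℂ) 𝓘(ℂ, ℂ) e ∧ MDifferentiable 𝓘(ℂ, ℂ) 𝓘(ℂ, ℂ) e.symm :=
  ⟨{ toFun := a.hom.toFun
     invFun := a.inv.toFun
     left_inv := iso_inv_toFun_apply a
     right_inv := iso_hom_toFun_apply a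
     continuous_toFun := a.hom.mdifferentiable.continuous
     continuous_invFun := a.inv.mdifferentiable.continuous }, rfl, rfl,
    a.hom.mdifferentiable, a.inv.mdifferentiable⟩

/-- **JUNCTION `Aut_{HolRS}(U) → Aut^hol(U)`**: an automorphism in `HolRS` of a connected open `U ⊆ ℂ`
(the Riemann surface `HolRS.ofOpen U`) has an underlying self-homeomorphism of `U` lying in
abc-iut-L4-t2's `holAut U = Aut^hol(U)` (holomorphic with holomorphic inverse).
[cite: MochizukiAbsTopIII2015, Definition 2.1 (i) p.50] -/
theorem exists_mem_holAut_of_iso (U : Opens ℂ) (hU : IsConnected (U : Set ℂ))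
    (a : ofOpen U hU ≅ ofOpen U hU) :
    ∃ φ : U ≃ₜ U, φ ∈ holAut U ∧ (⇑φ = a.hom.toFun) ∧ (⇑φ.symm = a.inv.toFun) := by
  obtain ⟨e, he, he', hd, hd'⟩ := exists_homeomorph_of_iso a
  exact ⟨e, (mem_holAut_iff e).mpr ⟨hd, hd'⟩, he, he'⟩

/-- **JUNCTION `Aut^hol(U) → End_{HolRS}(U)`**: every element of `holAut U` (a biholomorphic
self-homeomorphism of the connected open `U ⊆ ℂ`) underlies an endomorphism of `HolRS.ofOpen U` in
`HolRS` — a homeomorphism is finite étale (`IsFiniteEtale.of_homeomorph`).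
[cite: MochizukiAbsTopIII2015, Definition 4.1 (iii) p.103] -/
theorem exists_hom_of_mem_holAut (U : Opens ℂ) (hU : IsConnected (U : Set ℂ)) {σ : U ≃ₜ U}
    (hσ : σ ∈ holAut U) : ∃ u : ofOpen U hU ⟶ ofOpen U hU, u.toFun = σ :=
  ⟨{ toFun := σ
     mdifferentiable := ((mem_holAut_iff σ).mp hσ).1
     isFiniteEtale := IsFiniteEtale.of_homeomorph σ }, rfl⟩

/-- Every element of `holAut U` underlies an AUTOMORPHISM of `HolRS.ofOpen U` in `HolRS`.
[cite: MochizukiAbsTopIII2015, Definition 4.1 (iii) p.103] -/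
theorem exists_iso_of_mem_holAut (U : Opens ℂ) (hU : IsConnected (U : Set ℂ)) {σ : U ≃ₜ U}
    (hσ : σ ∈ holAut U) :
    ∃ a : ofOpen U hU ≅ ofOpen U hU, a.hom.toFun = σ ∧ a.inv.toFun = σ.symm := by
  obtain ⟨u, hu⟩ := exists_hom_of_mem_holAut U hU hσ
  obtain ⟨v, hv⟩ := exists_hom_of_mem_holAut U hU ((holAut U).inv_mem hσ)
  refine ⟨⟨u, v, hom_ext ?_, hom_ext ?_⟩, hu, ?_⟩
  · rw [comp_toFun, id_toFun, hu, hv]; exact σ.symm_comp_self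
  · rw [comp_toFun, id_toFun, hu, hv]; exact σ.self_comp_symm
  · exact hv

/-! ### §2 (H1) is invariant under isomorphism -/

section Transport

universe v u

variable {C : Type u} [Category.{v} C]

/-- **(H1) transports along isomorphisms** (any category): if every automorphism of `X` commuting with
all endomorphisms of `X` is the identity and `X ≅ Y`, then the same holds at `Y` (conjugate).
[cite: MochizukiAbsTopIII2015, Proposition 4.2 (i) p.106] -/
theorem h1_of_iso {X Y : C} (e : X ≅ Y)
    (h1 : ∀ a : X ≅ X, (∀ u : X ⟶ X, a.hom ≫ u = u ≫ a.hom) → a.hom = 𝟙 X)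
    (b : Y ≅ Y) (hb : ∀ v : Y ⟶ Y, b.hom ≫ v = v ≫ b.hom) : b.hom = 𝟙 Y := by
  have key : (e ≪≫ b ≪≫ e.symm).hom = 𝟙 X := by
    refine h1 (e ≪≫ b ≪≫ e.symm) fun u => ?_
    have hv := hb (e.inv ≫ u ≫ e.hom)
    simp only [Iso.trans_hom, Iso.symm_hom, Category.assoc]
    calc e.hom ≫ b.hom ≫ e.inv ≫ u
        = e.hom ≫ (b.hom ≫ e.inv ≫ u ≫ e.hom) ≫ e.inv := by simp
      _ = e.hom ≫ ((e.inv ≫ u ≫ e.hom) ≫ b.hom) ≫ e.inv := by rw [hv]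
      _ = u ≫ e.hom ≫ b.hom ≫ e.inv := by simp
  have hb' : b.hom = e.inv ≫ (e ≪≫ b ≪≫ e.symm).hom ≫ e.hom := by simp
  rw [hb', key, Category.id_comp, e.inv_hom_id]

end Transport

/-! ### §3 The thrice-punctured sphere: (H1) holds -/

section Tripod

variable {U : Opens ℂ} (hU : (U : Set ℂ) = {z | z ≠ 0 ∧ z ≠ 1}) (hUc : IsConnected (U : Set ℂ))

include hU in
/-- **(H1) at the thrice-punctured sphere** (any `U : Opens ℂ` with carrier `{z | z ≠ 0 ∧ z ≠ 1}`, as the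
Riemann surface `HolRS.ofOpen U`).  Every automorphism of `ℂ ∖ {0, 1}` in `HolRS` commuting with all
holomorphic finite étale endomorphisms of `ℂ ∖ {0, 1}` is the identity: by the classification
(`ThricePunctured.eq_one_of_six`) it is one of the six Möbius transformations permuting `0, 1, ∞`, and
the five non-trivial ones fail to commute with `z ↦ 1 - z` or with `z ↦ z⁻¹` (both holomorphic finite
étale endomorphisms) at `z = 2`. [cite: MochizukiAbsTopIII2015, Proposition 4.2 (i) p.106]
[cite: Conway1978, Ch. V Thm. 1.21] -/
theorem h1_ofOpen_tripod (a : ofOpen U hUc ≅ ofOpen U hUc)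
    (ha : ∀ u : ofOpen U hUc ⟶ ofOpen U hUc, a.hom ≫ u = u ≫ a.hom) : a.hom = 𝟙 _ := by
  obtain ⟨φ, hφ, hφa, -⟩ := exists_mem_holAut_of_iso U hUc a
  obtain ⟨σ, hσ, hσx⟩ := ThricePunctured.exists_oneSub_mem_holAut hU
  obtain ⟨τ, hτ, hτx⟩ := ThricePunctured.exists_inv_mem_holAut hU
  obtain ⟨uσ, huσ⟩ := exists_hom_of_mem_holAut U hUc hσ
  obtain ⟨uτ, huτ⟩ := exists_hom_of_mem_holAut U hUc hτ
  -- the commutation relations, pointwise in `ℂ`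
  have hcomm : ∀ {ρ : U ≃ₜ U} {u : ofOpen U hUc ⟶ ofOpen U hUc},
      u.toFun = ρ → ∀ x : U, (ρ (φ x) : ℂ) = φ (ρ x) := by
    intro ρ u hu x
    have h := congrFun (congrArg Hom.toFun (ha u)) x
    simp only [comp_toFun, Function.comp_apply, hu, ← hφa] at h
    exact congrArg Subtype.val h
  have cσ := hcomm huσ
  have cτ := hcomm huτ
  have h2 : (2 : ℂ) ∈ U := by rw [ThricePunctured.mem_iff hU]; norm_num
  rcases ThricePunctured.eq_one_of_six hU hφ with h | h | h | h | h | h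
  · -- `φ = id`
    apply hom_ext
    rw [id_toFun, ← hφa]
    funext x
    exact Subtype.ext (h x)
  · -- `φ = 1 - z` does not commute with `z ↦ z⁻¹`
    exfalso
    have e := cτ ⟨2, h2⟩
    simp only [hτx, h] at e
    norm_num at e
  · -- `φ = z⁻¹` does not commute with `z ↦ 1 - z`
    exfalso
    have e := cσ ⟨2, h2⟩
    simp only [hσx, h] at e
    norm_num at e
  · -- `φ = (1 - z)⁻¹` does not commute with `z ↦ 1 - z`
    exfalso
    have e := cσ ⟨2, h2⟩
    simp only [hσx, h] at e
    norm_num at e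
  · -- `φ = 1 - z⁻¹` does not commute with `z ↦ 1 - z`
    exfalso
    have e := cσ ⟨2, h2⟩
    simp only [hσx, h] at e
    norm_num at e
  · -- `φ = 1 - (1 - z)⁻¹` does not commute with `z ↦ 1 - z`
    exfalso
    have e := cσ ⟨2, h2⟩
    simp only [hσx, h] at e
    norm_num at e

include hU in
/-- **Every automorphism of the thrice-punctured sphere in `HolRS` is one of the six anharmonic maps**
(the classification, read through the junction). [cite: Conway1978, Ch. V Thm. 1.21] -/
theorem iso_ofOpen_tripod_eq_one_of_six (a : ofOpen U hUc ≅ ofOpen U hUc) :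
    (∀ x : U, Subtype.val (a.hom.toFun x) = (x : ℂ)) ∨
    (∀ x : U, Subtype.val (a.hom.toFun x) = 1 - (x : ℂ)) ∨
    (∀ x : U, Subtype.val (a.hom.toFun x) = (x : ℂ)⁻¹) ∨
    (∀ x : U, Subtype.val (a.hom.toFun x) = (1 - x : ℂ)⁻¹) ∨
    (∀ x : U, Subtype.val (a.hom.toFun x) = 1 - (x : ℂ)⁻¹) ∨
    (∀ x : U, Subtype.val (a.hom.toFun x) = 1 - (1 - x : ℂ)⁻¹) := by
  obtain ⟨φ, hφ, hφa, -⟩ := exists_mem_holAut_of_iso U hUc a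
  have key := ThricePunctured.eq_one_of_six hU hφ
  rw [hφa] at key
  exact key

end Tripod

section TripodObject

variable (hF : ({0, 1} : Set ℂ).Finite)

/-- The carrier set of `planeComplFinite {0,1}` is `{z | z ≠ 0 ∧ z ≠ 1}` (the shape consumed by the
tree's `ThricePunctured` file). [cite: Conway1978, Ch. V Def. 1.3] -/
theorem coe_opens_tripod :
    ((⟨({0, 1} : Set ℂ)ᶜ, hF.isClosed.isOpen_compl⟩ : Opens ℂ) : Set ℂ) = {z | z ≠ 0 ∧ z ≠ 1} := by
  ext z
  simp only [Opens.coe_mk, mem_compl_iff, mem_insert_iff, mem_singleton_iff, not_or, mem_setOf_eq]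

/-- **(H1) at `planeComplFinite {0, 1}`** — the object `ℂ ∖ {0,1}` of abc-iut-L4-t12 (gen 7)'s
instances file: every automorphism in `HolRS` commuting with all holomorphic finite étale endomorphisms
is the identity. [cite: MochizukiAbsTopIII2015, Proposition 4.2 (i) p.106] [cite: Conway1978, Ch. V Thm. 1.21] -/
theorem tripod_h1 (a : planeComplFinite {0, 1} hF ≅ planeComplFinite {0, 1} hF)
    (ha : ∀ u : planeComplFinite {0, 1} hF ⟶ planeComplFinite {0, 1} hF, a.hom ≫ u = u ≫ a.hom) :
    a.hom = 𝟙 _ :=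
  h1_ofOpen_tripod (U := ⟨({0, 1} : Set ℂ)ᶜ, hF.isClosed.isOpen_compl⟩) (coe_opens_tripod hF)
    (isConnected_compl_finite hF) a ha

/-- **«Objects of `EA^hol_RS(Q)` mapping to the thrice-punctured sphere» is id-rigid —
UNCONDITIONALLY.**  For every `Q ⊆ HolRS` closed under finite étale covers (e.g. `Q = ⊤`,
`isCoverClosed_top`; the hyperbolic connected Riemann surfaces) with `ℂ ∖ {0,1} ∈ Q`, the
full subcategory of `EA^hol_RS(Q) = Q.FullSubcategory` of objects admitting a morphism to `ℂ ∖ {0, 1}`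
is id-rigid: (H1) by `tripod_h1`, (3ε) by abc-iut-w5-d144/abc-iut-L6-t18 (free `π₁` of rank `2`, slim
profinite completion), assembled by `isIdRigid_mapsTo_planeComplFinite_of`.  This is print's «for any
object `X ∈ Ob(EA)` … the full subcategory of `EA` consisting of objects that map to `X` … [is
id-rigid]» at the object `X = ℙ¹ ∖ {0, 1, ∞}` of the geometric model.
[cite: MochizukiAbsTopIII2015, Proposition 4.2 (i) p.106] -/
theorem isIdRigid_mapsTo_thricePuncturedSphere (Q : ObjectProperty HolRS) (hQ : IsCoverClosed Q)
    (hXQ : Q (planeComplFinite {0, 1} hF)) :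
    IsIdRigid (ObjectProperty.FullSubcategory fun Y : Q.FullSubcategory =>
      Nonempty (Y ⟶ ⟨planeComplFinite {0, 1} hF, hXQ⟩)) :=
  isIdRigid_mapsTo_planeComplFinite_of Q hQ hF (by rw [Set.ncard_pair (zero_ne_one' ℂ)]) hXQ
    (tripod_h1 hF)

end TripodObject

/-! ### §4 Every twice-punctured plane `ℂ ∖ {p, q}`, `p ≠ q` -/

/-- **A homeomorphism of carriers, holomorphic in both directions, is an isomorphism of `HolRS`**
(homeomorphisms are finite étale). [cite: MochizukiAbsTopIII2015, Definition 4.1 (iii) p.103] -/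
theorem exists_iso_of_homeomorph {X Y : HolRS} (e : X.carrier ≃ₜ Y.carrier)
    (he : MDifferentiable 𝓘(ℂ, ℂ) 𝓘(ℂ, ℂ) e) (he' : MDifferentiable 𝓘(ℂ, ℂ) 𝓘(ℂ, ℂ) e.symm) :
    ∃ a : X ≅ Y, a.hom.toFun = e ∧ a.inv.toFun = e.symm :=
  ⟨⟨{ toFun := e, mdifferentiable := he, isFiniteEtale := IsFiniteEtale.of_homeomorph e },
    { toFun := e.symm, mdifferentiable := he', isFiniteEtale := IsFiniteEtale.of_homeomorph e.symm },
    hom_ext e.symm_comp_self, hom_ext e.self_comp_symm⟩, rfl, rfl⟩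

section PlaneComplPair

variable {p q : ℂ} (hpq : p ≠ q) (hF : ({p, q} : Set ℂ).Finite) (hF₀ : ({0, 1} : Set ℂ).Finite)

/-- Membership in the open set `ℂ ∖ {p, q}`. [cite: Conway1978, Ch. V Def. 1.3] -/
theorem mem_opens_compl_pair_iff {h : IsOpen (({p, q} : Set ℂ)ᶜ)} {z : ℂ} :
    z ∈ (⟨({p, q} : Set ℂ)ᶜ, h⟩ : Opens ℂ) ↔ z ≠ p ∧ z ≠ q := by
  change z ∈ ({p, q} : Set ℂ)ᶜ ↔ _
  simp only [mem_compl_iff, mem_insert_iff, mem_singleton_iff, not_or]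

include hpq in
/-- **The affine change of variable `z ↦ (z - p)/(q - p)` is a biholomorphism `ℂ ∖ {p, q} ≅ ℂ ∖ {0, 1}`**
(a homeomorphism of the carriers, holomorphic with holomorphic inverse `w ↦ p + w (q - p)`).
[cite: Conway1978, Ch. III §3] -/
theorem exists_homeomorph_planeComplPair_tripod :
    ∃ e : (planeComplFinite {p, q} hF).carrier ≃ₜ (planeComplFinite {0, 1} hF₀).carrier,
      MDifferentiable 𝓘(ℂ, ℂ) 𝓘(ℂ, ℂ) e ∧ MDifferentiable 𝓘(ℂ, ℂ) 𝓘(ℂ, ℂ) e.symm ∧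
      ∀ z : (⟨({p, q} : Set ℂ)ᶜ, hF.isClosed.isOpen_compl⟩ : Opens ℂ),
        Subtype.val (e z) = ((z : ℂ) - p) / (q - p) := by
  have hqp : q - p ≠ 0 := sub_ne_zero.mpr (Ne.symm hpq)
  -- the two affine maps and their algebra
  have hAB : ∀ w : ℂ, (p + w * (q - p) - p) / (q - p) = w := fun w => by
    field_simp; ring
  have hBA : ∀ z : ℂ, p + (z - p) / (q - p) * (q - p) = z := fun z => by
    field_simp; ring
  have hAmem : ∀ z : ℂ, z ∈ (⟨({p, q} : Set ℂ)ᶜ, hF.isClosed.isOpen_compl⟩ : Opens ℂ) →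
      (z - p) / (q - p) ∈ (⟨({0, 1} : Set ℂ)ᶜ, hF₀.isClosed.isOpen_compl⟩ : Opens ℂ) := by
    intro z hz
    rw [mem_opens_compl_pair_iff] at hz ⊢
    refine ⟨fun h => hz.1 ?_, fun h => hz.2 ?_⟩
    · rcases (div_eq_zero_iff).mp h with h | h
      · exact sub_eq_zero.mp h
      · exact absurd h hqp
    · rw [div_eq_one_iff_eq hqp] at h
      linear_combination h
  have hBmem : ∀ w : ℂ, w ∈ (⟨({0, 1} : Set ℂ)ᶜ, hF₀.isClosed.isOpen_compl⟩ : Opens ℂ) →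
      p + w * (q - p) ∈ (⟨({p, q} : Set ℂ)ᶜ, hF.isClosed.isOpen_compl⟩ : Opens ℂ) := by
    intro w hw
    rw [mem_opens_compl_pair_iff] at hw ⊢
    refine ⟨fun h => hw.1 ?_, fun h => hw.2 ?_⟩
    · have : w * (q - p) = 0 := by linear_combination h
      rcases mul_eq_zero.mp this with h' | h'
      · exact h'
      · exact absurd h' hqp
    · have : (w - 1) * (q - p) = 0 := by linear_combination h
      rcases mul_eq_zero.mp this with h' | h'
      · exact sub_eq_zero.mp h'
      · exact absurd h' hqp
  let e : (⟨({p, q} : Set ℂ)ᶜ, hF.isClosed.isOpen_compl⟩ : Opens ℂ) ≃ₜ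
      (⟨({0, 1} : Set ℂ)ᶜ, hF₀.isClosed.isOpen_compl⟩ : Opens ℂ) :=
    { toFun := fun z => ⟨((z : ℂ) - p) / (q - p), hAmem z z.2⟩
      invFun := fun w => ⟨p + (w : ℂ) * (q - p), hBmem w w.2⟩
      left_inv := fun z => Subtype.ext (hBA z)
      right_inv := fun w => Subtype.ext (hAB w)
      continuous_toFun := ((continuous_subtype_val.sub continuous_const).div_const _).subtype_mk _
      continuous_invFun := (continuous_const.add (continuous_subtype_val.mul continuous_const)).subtype_mk _ }
  have hA : MDifferentiable 𝓘(ℂ, ℂ) 𝓘(ℂ, ℂ) (fun z : ℂ => (z - p) / (q - p)) :=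
    mdifferentiable_iff_differentiable.mpr ((differentiable_id.sub (differentiable_const _)).div_const _)
  have hB : MDifferentiable 𝓘(ℂ, ℂ) 𝓘(ℂ, ℂ) (fun w : ℂ => p + w * (q - p)) :=
    mdifferentiable_iff_differentiable.mpr
      ((differentiable_const _).add (differentiable_id.mul (differentiable_const _)))
  exact ⟨e, mdifferentiable_opens_of_val_eq' hA e (fun _ => rfl),
    mdifferentiable_opens_of_val_eq' hB e.symm (fun _ => rfl), fun _ => rfl⟩

include hpq in
/-- **`ℂ ∖ {p, q} ≅ ℂ ∖ {0, 1}` in `HolRS`** (`p ≠ q`). [cite: Conway1978, Ch. III §3] -/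
theorem nonempty_iso_planeComplPair_tripod :
    Nonempty (planeComplFinite {p, q} hF ≅ planeComplFinite {0, 1} hF₀) := by
  obtain ⟨e, he, he', -⟩ := exists_homeomorph_planeComplPair_tripod hpq hF hF₀
  obtain ⟨a, -, -⟩ := exists_iso_of_homeomorph e he he'
  exact ⟨a⟩

include hpq in
/-- **(H1) at every twice-punctured plane `ℂ ∖ {p, q}`, `p ≠ q`**: an automorphism in `HolRS` commuting
with all holomorphic finite étale endomorphisms is the identity (transport of `tripod_h1` along the
affine biholomorphism). [cite: MochizukiAbsTopIII2015, Proposition 4.2 (i) p.106] [cite: Conway1978, Ch. V Thm. 1.21] -/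
theorem planeComplPair_h1 (a : planeComplFinite {p, q} hF ≅ planeComplFinite {p, q} hF)
    (ha : ∀ u : planeComplFinite {p, q} hF ⟶ planeComplFinite {p, q} hF, a.hom ≫ u = u ≫ a.hom) :
    a.hom = 𝟙 _ := by
  obtain ⟨e⟩ := nonempty_iso_planeComplPair_tripod hpq hF (Set.toFinite _)
  exact h1_of_iso e.symm (tripod_h1 (Set.toFinite _)) a ha

include hpq in
/-- **«Objects of `EA^hol_RS(Q)` mapping to `ℂ ∖ {p, q}`» is id-rigid — UNCONDITIONALLY** (`p ≠ q`; `Q`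
closed under finite étale covers, `ℂ ∖ {p, q} ∈ Q`): the `|F| = 2` case of
`isIdRigid_mapsTo_planeComplFinite_of` with (H1) discharged. [cite: MochizukiAbsTopIII2015, Proposition 4.2 (i) p.106] -/
theorem isIdRigid_mapsTo_planeComplPair (Q : ObjectProperty HolRS) (hQ : IsCoverClosed Q)
    (hXQ : Q (planeComplFinite {p, q} hF)) :
    IsIdRigid (ObjectProperty.FullSubcategory fun Y : Q.FullSubcategory =>
      Nonempty (Y ⟶ ⟨planeComplFinite {p, q} hF, hXQ⟩)) :=
  isIdRigid_mapsTo_planeComplFinite_of Q hQ hF (by rw [Set.ncard_pair hpq]) hXQ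
    (planeComplPair_h1 hpq hF)

/-- **The `|F| = 2` case in the shape of `isIdRigid_mapsTo_planeComplFinite_of`**: for `F ⊆ ℂ` with
exactly two elements, «objects of `EA^hol_RS(Q)` mapping to `ℂ ∖ F`» is id-rigid with NO residual
hypothesis. [cite: MochizukiAbsTopIII2015, Proposition 4.2 (i) p.106] -/
theorem isIdRigid_mapsTo_planeComplFinite_of_ncard_eq_two (Q : ObjectProperty HolRS)
    (hQ : IsCoverClosed Q) {F : Set ℂ} (hF : F.Finite) (h2 : F.ncard = 2)
    (hXQ : Q (planeComplFinite F hF)) :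
    IsIdRigid (ObjectProperty.FullSubcategory fun Y : Q.FullSubcategory =>
      Nonempty (Y ⟶ ⟨planeComplFinite F hF, hXQ⟩)) := by
  obtain ⟨p, q, hpq, rfl⟩ := Set.ncard_eq_two.mp h2
  exact isIdRigid_mapsTo_planeComplPair hpq hF Q hQ hXQ

end PlaneComplPair

end HolRS

end Literature.AnabelianGeometry.AbsoluteAnabelian
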